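/-
Copyright: the b2b-balaban T⁴-continuum CRUX team, row NE7b OWNER lineage `t4-ne7b-p1` (gen 118). Project licence.
-/
import Summits.QuantumFields.BalabanUV.T4Continuum.Spine.NE7b.SupTorusBackgroundDerivative

/-!
# THE REGIONAL (DIRICHLET) BACKGROUND IN THE CONVEX REGIME: for ANY set `Λ` of blocks of the coarse torus, prescribe the block
# means ON `Λ` and the field itself OFF the region `Ω = ⋃Λ` — one linear constraint `QΛ φ = k`; then for `u′ ≥ −λ`,
# `λ < min(2,a)` EVERY datum `k` (block field on `Λ`, boundary ∕ exterior field off `Ω`) carries EXACTLY ONE fine torus field with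
# `QΛ φ = k` solving the sitewise equation AT THE SITES OF `Ω`, it minimises the action on its fibre, and ANY such regional
# background map is differentiable at every datum (response = the regional fibre response) — the generic level of (92)∕(93)∕(100)∕
# (101) instantiated on the Dirichlet fibres; existence-uniqueness-regularity of [B4]-type regional backgrounds, NOT their locality
# (row NE7b, node U5c; (93) + (101) + TEA + INST + TDF BY NAME; [folklore])

Cell `pub-balaban`, sub-cell `t4`, spine estimate NE7b (`T4WeightBudget.RelWeightBound`; the cell's OWN estimate — NOT PRINTED in
[Bałaban 1983–89], NOT PROVED).  Crux-route work under `Spine/NE7b/` by the row OWNER (`t4-ne7b-p1` gen 118) under FREEZE (0)'s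
crux-prover clause, base layer of gen 117's located item (b) «the REGIONAL (Dirichlet ∕ ball) background»; NOTHING of Bałaban's is
named as a Lean object, valued or asserted; no `T4Continuum/Support` leaf typed; no `def`, no notation (the regional constraint `QΛ`
and its lift `MΛ` are ANY continuous linear maps with the displayed actions — their existence is §1); zero `sorry`.  Imports (BY
NAME): the OWNER's (101) `…SupTorusBackgroundDerivative` (`exists_hasFDerivAt_fibreCritical`; through it (93)
`existsUnique_critical_fibre`, (89) `torus_form_coercive`, TEA `fderiv_action_apply`, INST `fieldEq_periodic`, TDF
`torus_operator_form_symm` ∕ `sum_blockLift_mul_eq_zero` ∕ `blockOf_siteOf_of_mem` ∕ `blockOf_siteOf`, (72) `blockAvg_periodic`, PTC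
`exists_windowMap_siteOf`).

WHY (located).  Bałaban's backgrounds are REGIONAL: the variational problem is posed on a neighbourhood of the small-field region
with the configuration outside held fixed ([B4] §2–4), and the whole locality analysis compares the backgrounds of nested regions.
The convex road's theorems are stated for ANY constraint map `Qt` with a right inverse, so the Dirichlet problem is an INSTANCE: the
index carrier is `Λ ⊕ {x ∣ bt x ∉ Λ}`, `QΛ φ = (Q′t φ on Λ, φ off Ω)`, the lift `MΛ k` is the block lift on `Ω` and `k` itself off
`Ω`.  The one new computation is the regional form of (93)'s adjointness argument: a covector killing `ker QΛ` (fields supported in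
`Ω` with zero block means on `Λ`) is, ON `Ω`, the block lift of its block mean — so fibre-criticality for `QΛ` is the sitewise
equation at the lattice sites over `Ω`, and conversely.

WHAT IS PROVED ([folklore]):
* §1 (carriers `Site d ((n+1)s)`, `Site d s`, `Λ : Finset (Site d s)`; ANY `Dop, Ef, Rc` with the displayed actions)
  `exists_clm_regionalConstraint` (`∃ QΛ` with the two displayed components), `exists_clm_regionalLift` (`∃ MΛ`, displayed action,
  `QΛ∘MΛ = 1`), `blockAvg_eq_zero_of_regional` (`QΛ h = 0` ⟹ ALL torus block means of `h` vanish), `apply_eq_zero_of_regional`.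
* §2 **`regional_blockLift_of_critical`** (a covector killing `ker QΛ` is the block lift of its block mean ON `Ω`),
  **`regional_sitewise_of_critical`** (fibre-criticality of the torus action for `QΛ` ⟹ the LATTICE sitewise equation at every `p`
  with `siteOf (blk n p) ∈ Λ`), **`regional_critical_of_sitewise`** (conversely).
* §3 THE ENDs (`v′ = u`, `u′ ≥ −λ` on `ℝ`, `λ < min(2,a)`; every `Λ`, every datum) **`existsUnique_regional_background`** (exactly one
  field per Dirichlet fibre solving the sitewise equation over `Ω`; every such field minimises the action on the fibre),
  **`regional_background_hasFDerivAt`** (ANY regional background map `ΦΛ` is differentiable at every datum: `∃ D`, `QΛ(D k) = k`, the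
  linearised sitewise letter on `ker QΛ`, `HasFDerivAt ΦΛ D k₀`).
* §4 toy.

HONEST (what this is NOT).  Bookkeeping over the generic convex level; `Λ` arbitrary (no geometry: no collars, no distance to `∂Ω`),
so NOTHING about locality ∕ decoupling of the regional background from far data — that is [B4]'s content and the sup road's
(63)–(70) under two-sided letters; the Hessian of the regional effective action with its response floor follows verbatim from (102)
`hessian_fibreCritical` with `vol = 0` and is not restated; one-sided curvature; constants OURS; nothing about the measure; cubic
periods; scalar skeleton, hard constraint, not the covariant operators ((A3), NC-NE7b-α UNRULED); nothing of Bałaban's.  BY-NAME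
EFFECT ON THE WALL: NONE.  NE7b NOT PRINTED ∕ NOT PROVED; spine PROVED 0∕9; rung (B)+1 on a FINITE torus — NOT infinite volume, NOT
the mass gap, NOT Clay.  HONEST DEPENDENCY: continuum YM on T⁴ ⇐ BetaPertH ∧ nine spine estimates (0∕9 proved); BetaPertH ⇐ (D1) ∧
(D4) ∧ CAP+tail; G-an2-4 gates asym, D1 and NE2∕3∕4.
-/

set_option autoImplicit false

noncomputable section

namespace Summit.QuantumFields.BalabanUV.T4Continuum.NE7b.SupTorusRegionalBackground

open Set Function
open scoped ENNReal
open Literature.MathematicalPhysics.QuantumFieldTheory.Balaban1983to89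
open B6QGQLower276 (X blk B side AX mem_B sum_B_const)
open B5Hk103ScalarZd (nbhd)
open Beta (Site siteOf windowMap siteOf_windowMap)
open PeriodicSupTorusCarrier (exists_windowMap_siteOf)
open AugmentedInversePeriodic (blockAvg_periodic)
open SupTorusDirichletForm (torus_operator_form_symm sum_blockLift_mul_eq_zero blockOf_siteOf_of_mem blockOf_siteOf)
open SupTorusDirichletFormCoercive (torus_form_coercive)
open SupTorusEffectiveAction (fderiv_action_apply)
open SupTorusEffectiveActionInstance (fieldEq_periodic)
open SupTorusActionMinimiser (existsUnique_critical_fibre)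
open SupTorusBackgroundDerivative (exists_hasFDerivAt_fibreCritical)

variable {d : ℕ}

section Torus

variable (n : ℕ) (a : ℝ) (s : ℕ) [NeZero s] (Λ : Finset (Site d s))
  {Dop Aop : lp (fun _ : X d => ℝ) ∞ →L[ℝ] lp (fun _ : X d => ℝ) ∞}
  (hD : ∀ (f : lp (fun _ : X d => ℝ) ∞) (y : X d), Dop f y = (((n : ℝ) + 1) ^ d)⁻¹ * ∑ p ∈ B n y, f p)
  (hA : ∀ (f : lp (fun _ : X d => ℝ) ∞) (p : X d), Aop f p = ∑ r ∈ nbhd n p, AX n a p r * f r)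
  {v u u' : ℝ → ℝ} (hv : ∀ t, HasDerivAt v (u t) t) (hu : ∀ t, HasDerivAt u (u' t) t)
  {lam : ℝ} (hu' : ∀ t, -lam ≤ u' t) (hγ : lam < min 2 a)
  {Ef : (Site d ((n + 1) * s) → ℝ) →L[ℝ] lp (fun _ : X d => ℝ) ∞}
  (hEf : ∀ (g : Site d ((n + 1) * s) → ℝ) (q : X d), Ef g q = g (siteOf d ((n + 1) * s) q))
  {Rf : lp (fun _ : X d => ℝ) ∞ →L[ℝ] (Site d ((n + 1) * s) → ℝ)}
  (hRf : ∀ (h : lp (fun _ : X d => ℝ) ∞) (x : Site d ((n + 1) * s)), Rf h x = h (windowMap d ((n + 1) * s) x))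
  {Rc : lp (fun _ : X d => ℝ) ∞ →L[ℝ] (Site d s → ℝ)}
  (hRc : ∀ (h : lp (fun _ : X d => ℝ) ∞) (x : Site d s), Rc h x = h (windowMap d s x))
  {QΛ : (Site d ((n + 1) * s) → ℝ) →L[ℝ]
    (({y : Site d s // y ∈ Λ} ⊕ {x : Site d ((n + 1) * s) // siteOf d s (blk n (windowMap d ((n + 1) * s) x)) ∉ Λ}) → ℝ)}
  (hQl : ∀ (φ : Site d ((n + 1) * s) → ℝ) (y : {y : Site d s // y ∈ Λ}),
    QΛ φ (Sum.inl y) = ((Rc.comp Dop).comp Ef) φ y)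
  (hQr : ∀ (φ : Site d ((n + 1) * s) → ℝ)
    (x : {x : Site d ((n + 1) * s) // siteOf d s (blk n (windowMap d ((n + 1) * s) x)) ∉ Λ}), QΛ φ (Sum.inr x) = φ x)
  {MΛ : (({y : Site d s // y ∈ Λ} ⊕ {x : Site d ((n + 1) * s) // siteOf d s (blk n (windowMap d ((n + 1) * s) x)) ∉ Λ}) → ℝ)
    →L[ℝ] (Site d ((n + 1) * s) → ℝ)}
  (hM : ∀ k, QΛ (MΛ k) = k)

/-! ## §1. The Dirichlet constraint and its lift exist; a field in its kernel has no block means and vanishes off `Ω` -/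

/-- **THE REGIONAL CONSTRAINT AS A MAP**: `∃ QΛ`, `QΛ φ (inl y) = Q′t φ y` (block means on `Λ`), `QΛ φ (inr x) = φ x` (the field off
`Ω`). [folklore] -/
theorem exists_clm_regionalConstraint :
    ∃ QΛ : (Site d ((n + 1) * s) → ℝ) →L[ℝ]
      (({y : Site d s // y ∈ Λ} ⊕ {x : Site d ((n + 1) * s) // siteOf d s (blk n (windowMap d ((n + 1) * s) x)) ∉ Λ}) → ℝ),
      (∀ (φ : Site d ((n + 1) * s) → ℝ) (y : {y : Site d s // y ∈ Λ}), QΛ φ (Sum.inl y) = ((Rc.comp Dop).comp Ef) φ y) ∧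
      ∀ (φ : Site d ((n + 1) * s) → ℝ)
        (x : {x : Site d ((n + 1) * s) // siteOf d s (blk n (windowMap d ((n + 1) * s) x)) ∉ Λ}), QΛ φ (Sum.inr x) = φ x :=
  ⟨ContinuousLinearMap.pi (Sum.elim
      (fun y : {y : Site d s // y ∈ Λ} =>
        (ContinuousLinearMap.proj (R := ℝ) (φ := fun _ : Site d s => ℝ) (y : Site d s)).comp ((Rc.comp Dop).comp Ef))
      (fun x : {x : Site d ((n + 1) * s) // siteOf d s (blk n (windowMap d ((n + 1) * s) x)) ∉ Λ} =>
        ContinuousLinearMap.proj (R := ℝ) (φ := fun _ : Site d ((n + 1) * s) => ℝ) (x : Site d ((n + 1) * s)))),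
    fun _ _ => rfl, fun _ _ => rfl⟩

include hD hEf hRc hQl hQr in
/-- **THE REGIONAL LIFT**: `∃ MΛ` with `(MΛ k) x = k (inl (bt x))` on `Ω` and `= k (inr x)` off `Ω`, and `QΛ (MΛ k) = k`. [folklore] -/
theorem exists_clm_regionalLift :
    ∃ MΛ : (({y : Site d s // y ∈ Λ} ⊕
        {x : Site d ((n + 1) * s) // siteOf d s (blk n (windowMap d ((n + 1) * s) x)) ∉ Λ}) → ℝ)
      →L[ℝ] (Site d ((n + 1) * s) → ℝ),
      (∀ k (x : Site d ((n + 1) * s)), MΛ k x =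
        if h : siteOf d s (blk n (windowMap d ((n + 1) * s) x)) ∈ Λ then
          k (Sum.inl ⟨siteOf d s (blk n (windowMap d ((n + 1) * s) x)), h⟩) else k (Sum.inr ⟨x, h⟩)) ∧
      ∀ k, QΛ (MΛ k) = k := by
  classical
  let MΛ : (({y : Site d s // y ∈ Λ} ⊕
        {x : Site d ((n + 1) * s) // siteOf d s (blk n (windowMap d ((n + 1) * s) x)) ∉ Λ}) → ℝ)
      →L[ℝ] (Site d ((n + 1) * s) → ℝ) :=
    ContinuousLinearMap.pi fun x : Site d ((n + 1) * s) =>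
      if h : siteOf d s (blk n (windowMap d ((n + 1) * s) x)) ∈ Λ then
        ContinuousLinearMap.proj (R := ℝ)
          (φ := fun _ : ({y : Site d s // y ∈ Λ} ⊕
            {x : Site d ((n + 1) * s) // siteOf d s (blk n (windowMap d ((n + 1) * s) x)) ∉ Λ}) => ℝ)
          (Sum.inl ⟨siteOf d s (blk n (windowMap d ((n + 1) * s) x)), h⟩)
      else
        ContinuousLinearMap.proj (R := ℝ)
          (φ := fun _ : ({y : Site d s // y ∈ Λ} ⊕
            {x : Site d ((n + 1) * s) // siteOf d s (blk n (windowMap d ((n + 1) * s) x)) ∉ Λ}) => ℝ)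
          (Sum.inr ⟨x, h⟩)
  have hMΛ : ∀ k (x : Site d ((n + 1) * s)), MΛ k x =
      if h : siteOf d s (blk n (windowMap d ((n + 1) * s) x)) ∈ Λ then
        k (Sum.inl ⟨siteOf d s (blk n (windowMap d ((n + 1) * s) x)), h⟩) else k (Sum.inr ⟨x, h⟩) := fun k x => by
    simp only [MΛ, ContinuousLinearMap.pi_apply]
    split_ifs <;> rfl
  refine ⟨MΛ, hMΛ, fun k => funext fun c => ?_⟩
  rcases c with y | x
  · -- a block of `Λ`: the lift is constant `k (inl y)` on it
    rw [hQl, ContinuousLinearMap.comp_apply, ContinuousLinearMap.comp_apply, hRc, hD]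
    simp only [hEf]
    have hvol : (((n : ℝ) + 1) ^ d) ≠ 0 := by positivity
    have hterm : ∀ p ∈ B n (windowMap d s (y : Site d s)), MΛ k (siteOf d ((n + 1) * s) p) = k (Sum.inl y) :=
      fun p hp => by
      have hb : siteOf d s (blk n (windowMap d ((n + 1) * s) (siteOf d ((n + 1) * s) p))) = y :=
        blockOf_siteOf_of_mem n s hp
      have hmem : siteOf d s (blk n (windowMap d ((n + 1) * s) (siteOf d ((n + 1) * s) p))) ∈ Λ := by
        rw [hb]; exact y.2
      have hsub : (⟨siteOf d s (blk n (windowMap d ((n + 1) * s) (siteOf d ((n + 1) * s) p))), hmem⟩ :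
          {y : Site d s // y ∈ Λ}) = y := Subtype.ext hb
      rw [hMΛ, dif_pos hmem, hsub]
    rw [Finset.sum_congr rfl hterm, sum_B_const, inv_mul_cancel_left₀ hvol]
  · rw [hQr, hMΛ, dif_neg x.2]

include hD hEf hRc hQl hQr in
/-- **A FIELD IN `ker QΛ` HAS NO BLOCK MEANS AT ALL**: `QΛ h = 0` ⟹ `Q′t h = 0` on the whole coarse torus (on `Λ` by the
constraint, off `Λ` because `h` vanishes there sitewise). [folklore] -/
theorem blockAvg_eq_zero_of_regional {h : Site d ((n + 1) * s) → ℝ} (hh : QΛ h = 0) : ((Rc.comp Dop).comp Ef) h = 0 := by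
  funext y
  by_cases hy : y ∈ Λ
  · have := hQl h ⟨y, hy⟩
    rw [hh] at this
    exact this.symm
  · rw [ContinuousLinearMap.comp_apply, ContinuousLinearMap.comp_apply, hRc, hD, Pi.zero_apply]
    simp only [hEf]
    rw [Finset.sum_eq_zero fun p hp => ?_, mul_zero]
    have hx : siteOf d s (blk n (windowMap d ((n + 1) * s) (siteOf d ((n + 1) * s) p))) ∉ Λ := by
      rw [blockOf_siteOf_of_mem n s hp]; exact hy
    have := hQr h ⟨siteOf d ((n + 1) * s) p, hx⟩
    rw [hh] at this
    exact this.symm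

include hQr in
/-- **… AND VANISHES OFF `Ω`**: `QΛ h = 0`, `bt x ∉ Λ` ⟹ `h x = 0`. [folklore] -/
theorem apply_eq_zero_of_regional {h : Site d ((n + 1) * s) → ℝ} (hh : QΛ h = 0) {x : Site d ((n + 1) * s)}
    (hx : siteOf d s (blk n (windowMap d ((n + 1) * s) x)) ∉ Λ) : h x = 0 := by
  have := hQr h ⟨x, hx⟩
  rw [hh] at this
  exact this.symm

/-! ## §2. Regional fibre-criticality is the sitewise equation over `Ω` -/

include hD hEf hRc hQl hQr in
/-- **A COVECTOR KILLING THE DIRICHLET FIBRE IS THE BLOCK LIFT OF ITS BLOCK MEAN ON `Ω`**: if `Σ_x F x·h x = 0` for every `h` with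
`QΛ h = 0`, then `F x = (Q′t F)(bt x)` at every fine site `x` with `bt x ∈ Λ`. [folklore] -/
theorem regional_blockLift_of_critical (F : Site d ((n + 1) * s) → ℝ)
    (hF : ∀ h : Site d ((n + 1) * s) → ℝ, QΛ h = 0 → ∑ x, F x * h x = 0) {x : Site d ((n + 1) * s)}
    (hx : siteOf d s (blk n (windowMap d ((n + 1) * s) x)) ∈ Λ) :
    F x = ((Rc.comp Dop).comp Ef) F (siteOf d s (blk n (windowMap d ((n + 1) * s) x))) := by
  classical
  set c : Site d s → ℝ := ((Rc.comp Dop).comp Ef) F with hc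
  set h : Site d ((n + 1) * s) → ℝ := fun x =>
    if siteOf d s (blk n (windowMap d ((n + 1) * s) x)) ∈ Λ then
      F x - c (siteOf d s (blk n (windowMap d ((n + 1) * s) x))) else 0 with hh
  -- all block means of `h` vanish
  have hQh : Rc (Dop (Ef h)) = 0 := by
    funext y
    rw [hRc, hD, Pi.zero_apply]
    simp only [hEf]
    by_cases hy : y ∈ Λ
    · have hvol : (((n : ℝ) + 1) ^ d) ≠ 0 := by positivity
      have hterm : ∀ p ∈ B n (windowMap d s y), h (siteOf d ((n + 1) * s) p) = F (siteOf d ((n + 1) * s) p) - c y :=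
        fun p hp => by simp only [hh]; rw [blockOf_siteOf_of_mem n s hp, if_pos hy]
      rw [Finset.sum_congr rfl hterm, Finset.sum_sub_distrib, sum_B_const, mul_sub, inv_mul_cancel_left₀ hvol]
      have hcy : c y = (((n : ℝ) + 1) ^ d)⁻¹ * ∑ p ∈ B n (windowMap d s y), F (siteOf d ((n + 1) * s) p) := by
        rw [hc, ContinuousLinearMap.comp_apply, ContinuousLinearMap.comp_apply, hRc, hD]
        simp only [hEf]
      rw [hcy, sub_self]
    · rw [Finset.sum_eq_zero fun p hp => ?_, mul_zero]
      simp only [hh]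
      rw [blockOf_siteOf_of_mem n s hp, if_neg hy]
  -- hence `h ∈ ker QΛ`
  have hQΛh : QΛ h = 0 := by
    funext c'
    rcases c' with y | x'
    · rw [hQl, Pi.zero_apply, ContinuousLinearMap.comp_apply, ContinuousLinearMap.comp_apply, hQh, Pi.zero_apply]
    · rw [hQr, Pi.zero_apply]
      simp only [hh]
      rw [if_neg x'.2]
  have h0 := hF h hQΛh
  -- `Σ F·h = Σ h² + Σ (c∘bt)·h`, the last sum vanishing with the block means of `h`
  have hsplit : ∑ x, F x * h x = ∑ x, h x ^ 2 + ∑ x, c (siteOf d s (blk n (windowMap d ((n + 1) * s) x))) * h x := by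
    rw [← Finset.sum_add_distrib]
    refine Finset.sum_congr rfl fun x _ => ?_
    simp only [hh]
    split_ifs <;> ring
  rw [hsplit, sum_blockLift_mul_eq_zero n s hD hEf hRc c hQh, add_zero] at h0
  have hxz := (Finset.sum_eq_zero_iff_of_nonneg fun x _ => sq_nonneg (h x)).1 h0 x (Finset.mem_univ x)
  rw [sq_eq_zero_iff] at hxz
  simp only [hh] at hxz
  rw [if_pos hx] at hxz
  exact sub_eq_zero.1 hxz

include hD hA hEf hRf hRc hQl hQr in
/-- **REGIONAL FIBRE-CRITICALITY IS THE LATTICE SITEWISE EQUATION OVER `Ω`**: if `DS(φ)` kills `ker QΛ` (torus action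
`S φ = ½Σ φ·(Rf(A(Ef φ))) + Σ v(φ x)`), then at every lattice site `p` whose block lies in `Λ` (`siteOf (blk n p) ∈ Λ`)
`A(Ef φ) p + u(Ef φ p)` equals its own block mean. [folklore] -/
theorem regional_sitewise_of_critical {v u : ℝ → ℝ} (hv : ∀ t, HasDerivAt v (u t) t) (φ : Site d ((n + 1) * s) → ℝ)
    (hcrit : ∀ h : Site d ((n + 1) * s) → ℝ, QΛ h = 0 →
      fderiv ℝ (fun φ : Site d ((n + 1) * s) → ℝ =>
        (1 / 2 : ℝ) * ∑ x, φ x * ((Rf.comp Aop).comp Ef) φ x + ∑ x, v (φ x)) φ h = 0)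
    {p : X d} (hp : siteOf d s (blk n p) ∈ Λ) :
    Aop (Ef φ) p + u (Ef φ p) = (((n : ℝ) + 1) ^ d)⁻¹ * ∑ p' ∈ B n (blk n p), (Aop (Ef φ) p' + u (Ef φ p')) := by
  set F : Site d ((n + 1) * s) → ℝ := fun x => ((Rf.comp Aop).comp Ef) φ x + u (φ x) with hFdef
  have hF : ∀ h : Site d ((n + 1) * s) → ℝ, QΛ h = 0 → ∑ x, F x * h x = 0 := fun h hh => by
    have h0 := hcrit h hh
    rw [fderiv_action_apply ((Rf.comp Aop).comp Ef) (torus_operator_form_symm n a s hA hEf hRf) hv φ h] at h0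
    exact h0
  -- the lattice field `G = A(Ef φ) + u∘(Ef φ)` is periodic and reads `G q = F (siteOf q)`
  have hperA : ∀ q t : X d, (Aop (Ef φ) : X d → ℝ) (q + side n • ((s : ℤ) • t)) = Aop (Ef φ) q := fun q t => by
    have h1 := fieldEq_periodic n a s hA hEf φ u q t
    have h2 : (Ef φ : X d → ℝ) (q + side n • ((s : ℤ) • t)) = Ef φ q := by
      rw [hEf, hEf, ← PeriodicSupTorusCarrier.natCast_mul_smul_eq, PeriodicSupTorusCarrier.siteOf_add_smul]
    rw [h2] at h1
    linarith
  have hG : ∀ q : X d, Aop (Ef φ) q + u (Ef φ q) = F (siteOf d ((n + 1) * s) q) := fun q => by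
    simp only [hFdef, ContinuousLinearMap.comp_apply]
    rw [hRf, hEf]
    obtain ⟨m, hm⟩ := exists_windowMap_siteOf ((n + 1) * s) q
    rw [hm, PeriodicSupTorusCarrier.natCast_mul_smul_eq, hperA]
  -- on `Ω`, `F` is the block lift of its block mean
  have hc : ∀ q : X d, siteOf d s (blk n q) ∈ Λ →
      F (siteOf d ((n + 1) * s) q) = ((Rc.comp Dop).comp Ef) F (siteOf d s (blk n q)) := fun q hq => by
    have hq' : siteOf d s (blk n (windowMap d ((n + 1) * s) (siteOf d ((n + 1) * s) q))) ∈ Λ := by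
      rw [blockOf_siteOf]; exact hq
    rw [regional_blockLift_of_critical n s Λ hD hEf hRc hQl hQr F hF hq', blockOf_siteOf]
  rw [hG p, hc p hp]
  rw [Finset.sum_congr rfl fun p' (hp' : p' ∈ B n (blk n p)) => by
      rw [hG p', hc p' (by rw [mem_B.1 hp']; exact hp), mem_B.1 hp'],
    sum_B_const, inv_mul_cancel_left₀ (by positivity : (((n : ℝ) + 1) ^ d) ≠ 0)]

include hD hA hEf hRf hRc hQl hQr in
/-- **CONVERSELY: THE SITEWISE EQUATION OVER `Ω` GIVES REGIONAL FIBRE-CRITICALITY**: if `A(Ef φ) + u∘(Ef φ)` equals its own block mean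
at every lattice site over `Ω`, then `DS(φ) h = 0` for every `h` with `QΛ h = 0`. [folklore] -/
theorem regional_critical_of_sitewise {v u : ℝ → ℝ} (hv : ∀ t, HasDerivAt v (u t) t) (φ : Site d ((n + 1) * s) → ℝ)
    (heq : ∀ p : X d, siteOf d s (blk n p) ∈ Λ →
      Aop (Ef φ) p + u (Ef φ p) = (((n : ℝ) + 1) ^ d)⁻¹ * ∑ p' ∈ B n (blk n p), (Aop (Ef φ) p' + u (Ef φ p')))
    (h : Site d ((n + 1) * s) → ℝ) (hh : QΛ h = 0) :
    fderiv ℝ (fun φ : Site d ((n + 1) * s) → ℝ =>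
      (1 / 2 : ℝ) * ∑ x, φ x * ((Rf.comp Aop).comp Ef) φ x + ∑ x, v (φ x)) φ h = 0 := by
  rw [fderiv_action_apply ((Rf.comp Aop).comp Ef) (torus_operator_form_symm n a s hA hEf hRf) hv φ h]
  -- the block means of the field equation, as a coarse field
  set c : Site d s → ℝ := fun y =>
    (((n : ℝ) + 1) ^ d)⁻¹ * ∑ p' ∈ B n (windowMap d s y), (Aop (Ef φ) p' + u (Ef φ p')) with hc
  have hper := fieldEq_periodic n a s hA hEf φ u
  -- over `Ω` the covector is `c ∘ bt`; off `Ω` the test field vanishes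
  have hpt : ∀ x : Site d ((n + 1) * s),
      (((Rf.comp Aop).comp Ef) φ x + u (φ x)) * h x = c (siteOf d s (blk n (windowMap d ((n + 1) * s) x))) * h x := by
    intro x
    by_cases hx : siteOf d s (blk n (windowMap d ((n + 1) * s) x)) ∈ Λ
    · congr 1
      have h1 : ((Rf.comp Aop).comp Ef) φ x = Aop (Ef φ) (windowMap d ((n + 1) * s) x) := by
        rw [ContinuousLinearMap.comp_apply, ContinuousLinearMap.comp_apply, hRf]
      have h2 : φ x = Ef φ (windowMap d ((n + 1) * s) x) := by rw [hEf, siteOf_windowMap]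
      rw [h1, h2, heq _ hx, hc]
      obtain ⟨m, hm⟩ := exists_windowMap_siteOf s (blk n (windowMap d ((n + 1) * s) x))
      simp only
      rw [hm, blockAvg_periodic n s hper]
    · rw [apply_eq_zero_of_regional n s Λ hQr hh hx, mul_zero, mul_zero]
  rw [Finset.sum_congr rfl fun x _ => hpt x]
  exact sum_blockLift_mul_eq_zero n s hD hEf hRc c (by
    have := blockAvg_eq_zero_of_regional n s Λ hD hEf hRc hQl hQr hh
    simpa only [ContinuousLinearMap.comp_apply] using this)

/-! ## §3. THE ENDs: existence, uniqueness, minimality, differentiability of the regional background -/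

include hD hA hv hu hu' hγ hEf hRf hRc hQl hQr hM in
/-- **THE END: EVERY DIRICHLET FIBRE CARRIES EXACTLY ONE REGIONAL BACKGROUND, AND IT MINIMISES.**  `v′ = u`, `u′` a derivative of `u`
with `u′ ≥ −λ` on `ℝ`, `λ < min(2,a)`; ANY set of blocks `Λ`; ANY `QΛ, MΛ` with the displayed actions.  For EVERY datum `k` (block
means on `Λ`, exterior field off `Ω`) there is EXACTLY ONE fine torus field `φ` with `QΛ φ = k` solving the sitewise equation at every
lattice site over `Ω`, AND every such `φ` minimises `S` on `{ψ | QΛ ψ = k}` — every mesh, period, dimension; no smallness of `k`.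
[folklore] -/
theorem existsUnique_regional_background
    (k : ({y : Site d s // y ∈ Λ} ⊕
      {x : Site d ((n + 1) * s) // siteOf d s (blk n (windowMap d ((n + 1) * s) x)) ∉ Λ}) → ℝ) :
    (∃! φ : Site d ((n + 1) * s) → ℝ, QΛ φ = k ∧
      ∀ p : X d, siteOf d s (blk n p) ∈ Λ →
        Aop (Ef φ) p + u (Ef φ p) = (((n : ℝ) + 1) ^ d)⁻¹ * ∑ p' ∈ B n (blk n p), (Aop (Ef φ) p' + u (Ef φ p'))) ∧
    ∀ φ : Site d ((n + 1) * s) → ℝ, QΛ φ = k →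
      (∀ p : X d, siteOf d s (blk n p) ∈ Λ →
        Aop (Ef φ) p + u (Ef φ p) = (((n : ℝ) + 1) ^ d)⁻¹ * ∑ p' ∈ B n (blk n p), (Aop (Ef φ) p' + u (Ef φ p'))) →
      IsMinOn (fun φ : Site d ((n + 1) * s) → ℝ => (1 / 2 : ℝ) * ∑ x, φ x * ((Rf.comp Aop).comp Ef) φ x + ∑ x, v (φ x))
        {ψ | QΛ ψ = k} φ := by
  have hsymm := torus_operator_form_symm n a s hA hEf hRf
  have hfloor := torus_form_coercive n a s hA hEf hRf
  obtain ⟨⟨φ, ⟨hφQ, hφcrit⟩, huniq⟩, hmin⟩ := existsUnique_critical_fibre ((Rf.comp Aop).comp Ef) hsymm hfloor hv hu hu' hγ QΛ (MΛ k)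
  rw [hM] at hφQ hmin
  refine ⟨⟨φ, ⟨hφQ, fun p hp => regional_sitewise_of_critical n a s Λ hD hA hEf hRf hRc hQl hQr hv φ hφcrit hp⟩,
      fun ψ hψ => huniq ψ ⟨hψ.1.trans (hM k).symm, ?_⟩⟩,
    fun φ' hφ' heq => hmin φ' hφ'
      fun h hh => regional_critical_of_sitewise n a s Λ hD hA hEf hRf hRc hQl hQr hv φ' heq h hh⟩
  exact fun h hh => regional_critical_of_sitewise n a s Λ hD hA hEf hRf hRc hQl hQr hv ψ hψ.2 h hh

include hD hA hv hu hu' hγ hEf hRf hRc hQl hQr hM in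
/-- **THE END: ANY REGIONAL BACKGROUND MAP IS DIFFERENTIABLE AT EVERY DATUM, DERIVATIVE = THE REGIONAL FIBRE RESPONSE.**  Same
letters; `ΦΛ` ANY map with `QΛ (ΦΛ k) = k` and the sitewise equation over `Ω` at every datum `k` (exists uniquely by
`existsUnique_regional_background`).  Then at EVERY datum `k₀`: `∃ D` continuous linear with `QΛ (D k) = k`,
`Σ_x ((At(D k)) x + u′(ΦΛ k₀ x)·(D k) x)·κ x = 0` for every `κ ∈ ker QΛ`, and `HasFDerivAt ΦΛ D k₀` — the background responds
differentiably to the block data on `Λ` AND to the exterior field. [folklore] -/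
theorem regional_background_hasFDerivAt
    (ΦΛ : (({y : Site d s // y ∈ Λ} ⊕
      {x : Site d ((n + 1) * s) // siteOf d s (blk n (windowMap d ((n + 1) * s) x)) ∉ Λ}) → ℝ) →
        (Site d ((n + 1) * s) → ℝ))
    (hΦQ : ∀ k, QΛ (ΦΛ k) = k)
    (hΦeq : ∀ k (p : X d), siteOf d s (blk n p) ∈ Λ →
      Aop (Ef (ΦΛ k)) p + u (Ef (ΦΛ k) p)
        = (((n : ℝ) + 1) ^ d)⁻¹ * ∑ p' ∈ B n (blk n p), (Aop (Ef (ΦΛ k)) p' + u (Ef (ΦΛ k) p')))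
    (k₀ : ({y : Site d s // y ∈ Λ} ⊕
      {x : Site d ((n + 1) * s) // siteOf d s (blk n (windowMap d ((n + 1) * s) x)) ∉ Λ}) → ℝ) :
    ∃ D : (({y : Site d s // y ∈ Λ} ⊕
        {x : Site d ((n + 1) * s) // siteOf d s (blk n (windowMap d ((n + 1) * s) x)) ∉ Λ}) → ℝ)
          →L[ℝ] (Site d ((n + 1) * s) → ℝ),
      (∀ k, QΛ (D k) = k) ∧
      (∀ k (κ' : Site d ((n + 1) * s) → ℝ), QΛ κ' = 0 →
        ∑ x, (((Rf.comp Aop).comp Ef) (D k) x + u' (ΦΛ k₀ x) * D k x) * κ' x = 0) ∧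
      HasFDerivAt ΦΛ D k₀ := by
  classical
  exact exists_hasFDerivAt_fibreCritical ((Rf.comp Aop).comp Ef) (torus_operator_form_symm n a s hA hEf hRf)
    (torus_form_coercive n a s hA hEf hRf) hv hu hu' hγ QΛ MΛ hM ΦΛ hΦQ
    (fun k h hh => regional_critical_of_sitewise n a s Λ hD hA hEf hRf hRc hQl hQr hv (ΦΛ k) (hΦeq k) h hh) k₀

end Torus

/-! ## §4. Toy -/

/-- Toy (§1 on the one-dimensional tori with one-site blocks and `Λ = ∅`: the regional constraint exists for ANY carrier maps — it
reads `QΛ φ (inr x) = φ x`). -/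
example (Dop : lp (fun _ : X 1 => ℝ) ∞ →L[ℝ] lp (fun _ : X 1 => ℝ) ∞)
    (Ef : (Site 1 ((0 + 1) * 1) → ℝ) →L[ℝ] lp (fun _ : X 1 => ℝ) ∞) (Rc : lp (fun _ : X 1 => ℝ) ∞ →L[ℝ] (Site 1 1 → ℝ)) :
    ∃ QΛ : (Site 1 ((0 + 1) * 1) → ℝ) →L[ℝ]
      (({y : Site 1 1 // y ∈ (∅ : Finset (Site 1 1))} ⊕
        {x : Site 1 ((0 + 1) * 1) // siteOf 1 1 (blk 0 (windowMap 1 ((0 + 1) * 1) x)) ∉ (∅ : Finset (Site 1 1))}) → ℝ),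
      (∀ (φ : Site 1 ((0 + 1) * 1) → ℝ) (y : {y : Site 1 1 // y ∈ (∅ : Finset (Site 1 1))}),
        QΛ φ (Sum.inl y) = ((Rc.comp Dop).comp Ef) φ y) ∧
      ∀ (φ : Site 1 ((0 + 1) * 1) → ℝ)
        (x : {x : Site 1 ((0 + 1) * 1) // siteOf 1 1 (blk 0 (windowMap 1 ((0 + 1) * 1) x)) ∉ (∅ : Finset (Site 1 1))}),
        QΛ φ (Sum.inr x) = φ x :=
  exists_clm_regionalConstraint 0 1 ∅ (Dop := Dop) (Ef := Ef) (Rc := Rc)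

end Summit.QuantumFields.BalabanUV.T4Continuum.NE7b.SupTorusRegionalBackground

end
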